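import Literature.Computability.AlgebraicComplexity.QuantumFunctionalPoint
import Literature.Computability.AlgebraicComplexity.QuantumFunctionalsSpectralPoint
import Literature.Computability.AlgebraicComplexity.QuantumFunctionalsUpper
import Literature.Computability.AlgebraicComplexity.TensorSemiring
import HarnessLib

/-!
# The quantum functionals as points of `Δ(T)`: what is proved, and the remaining trust base

Topic `Literature/Computability/AlgebraicComplexity`; sibling of `QuantumFunctionalPoint.lean`, whose
named fact `ChristandlVranaZuiddam2023_mem_asymptoticSpectrum` (Christandl–Vrana–Zuiddam, JAMS 36
(2023) = arXiv:1709.07851v3, Cor. 3.31: "Let `θ ∈ P_s(B)`. Then `F^θ = F_θ` is a point in the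
asymptotic spectrum `Δ(T)`, a universal spectral point"; `k = 3`) asks that for every `θ ∈ P([3])`
the spectral map `quantumFunctionalPoint θ` (the lower functional `F_θ = quantumFunctional θ`,
Def. 3.16) be nonnegative, additive under `⊕`, multiplicative under `⊗`, normalised on `⟨1⟩` and
monotone under restriction.

## Status of the five axioms (all index types in `Type`)

| axiom of `IsUniversalSpectralPoint` | source | Lean |
|---|---|---|
| `0 ≤ F` | Thm. 3.19.5 | `quantumFunctionalPoint_nonneg` (proved, `QuantumFunctionalPoint.lean`) |
| `F(⟨1⟩) = 1` (indeed `F(⟨r⟩) = r`) | Thm. 3.19.1 = Ex. 3.18 | `ChristandlVranaZuiddam2023_unitTensor_holds` (proved, `QuantumFunctionalsProofs.lean`) |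
| `s ≤ t ⇒ F(s) ≤ F(t)` | Cor. 3.31 via Thm. 3.19.4, Rem. 1.2, Rem. 3.17 | `ChristandlVranaZuiddam2023_restriction_mono_holds` (proved, `QuantumFunctionalsRestrictionProofs.lean`) |
| `F(s ⊕ t) = F(s) + F(t)` | `≥`: Thm. 3.19.2 = Lem. 3.22; `≤`: Lem. 3.11 + Thm. 3.24 + Thm. 3.30 | `≥` proved (`quantumFunctional_add_le_directSumTensor`, `QuantumFunctionalsDirectSum.lean`); `≤` is the named fact `ChristandlVranaZuiddam2023_directSum_subadditive` (`QuantumFunctionalsDirectSum.lean`) |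
| `F(s ⊗ t) = F(s) F(t)` | `≥`: Thm. 3.19.3 = Lem. 3.23; `≤`: Lem. 3.13 + Thm. 3.24 + Thm. 3.30 | `≥` proved (`ChristandlVranaZuiddam2023_kronecker_ge`, `QuantumFunctionalsKronecker.lean`); `≤` is the named fact `ChristandlVranaZuiddam2023_kronecker_le` (`QuantumFunctionalsKroneckerFacts.lean`) |

The two `≤` halves are the deep content of the paper: they are proved there for the *upper* quantum
functional `F^θ`, defined through the isotypic projectors `P_λ` of Schur–Weyl duality (Def. 3.3),
using the semigroup property of the Littlewood–Richardson and Kronecker coefficients (Rem. 3.9,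
Lem. 3.10–3.13), and transferred to `F_θ` by `F_θ ≤ F^θ` (Thm. 3.24: gentle measurement, Lem. 3.25,
and Keyl–Werner spectrum estimation, Thm. 3.27) and `F^θ = F_θ` on `P_s(B)` (Thm. 3.30, through the
entanglement-polytope theorem 3.29 of Brion / Walter–Doran–Gross–Christandl). None of this
representation theory is available in Mathlib at the pin, so `ChristandlVranaZuiddam2023_mem_asymptoticSpectrum`
is NOT discharged here. The two `≤` halves are vendored as the named facts
`ChristandlVranaZuiddam2023_directSum_subadditive` (`QuantumFunctionalsDirectSum.lean`) and
`ChristandlVranaZuiddam2023_kronecker_le` (`QuantumFunctionalsKroneckerFacts.lean`); this file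

* proves that the main theorem in the tree's `Δ(T)` form is *equivalent* to the conjunction of the two
  deep halves, `ChristandlVranaZuiddam2023_mem_asymptoticSpectrum ↔ _directSum_subadditive.{0} ∧ _kronecker_le.{0}`
  (`ChristandlVranaZuiddam2023_mem_asymptoticSpectrum_of_halves`, `…_iff_halves`; the conjunction form
  `ChristandlVranaZuiddam2023_universalSpectralPoint_iff_halves` is in `QuantumFunctionalsSpectralPoint.lean`),
  so that the trust base of every consumer of `(h : ChristandlVranaZuiddam2023_mem_asymptoticSpectrum)` is
  exactly these two named inequalities; and, one layer down, derives membership from the three named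
  facts of `QuantumFunctionalsUpper.lean` about the upper functional `F^θ` in coordinates — Lem. 3.11
  (`_upper_subadditive`), Lem. 3.13 (`_upper_submultiplicative`) and Thm. 3.30 (`_upper_eq_lower`) —
  in `ChristandlVranaZuiddam2023_mem_asymptoticSpectrum_of_upper`;
* records the unconditional content for the spectral map itself: `quantumFunctionalPoint θ` is
  nonnegative, normalised (`quantumFunctionalPoint_unitTensor`), restriction-monotone
  (`quantumFunctionalPoint_mono`), super-additive (`quantumFunctionalPoint_directSum_ge`) and
  super-multiplicative (`quantumFunctionalPoint_kronecker_ge`) — i.e. `F_θ` is what Strassen calls a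
  *lower* (super-additive, super-multiplicative, monotone, normalised) functional on all complex
  3-tensors, unconditionally; and that `F_θ` is invariant under padding with zero blocks,
  `F_θ(s ⊕ 0) = F_θ(s) = F_θ(0 ⊕ s)` (Rem. 3.17: "`E_θ` is not sensitive to embedding each `V_j` in
  some larger vector space"; §1.2: the equivalence `∼`), hence constant on the classes of the tensor
  semiring `T(ℂ)` (`quantumFunctional_eq_of_mk_eq_mk`, via `TensorSemiring.lean`).

## Source

M. Christandl, P. Vrana, J. Zuiddam, *Universal points in the asymptotic spectrum of tensors*,
J. Amer. Math. Soc. 36 (2023) 31–79 = arXiv:1709.07851v3: §3 introduction (p. 11), Thm. 3.5 and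
Lem. 3.11 (pp. 12–13), Thm. 3.19 (p. 14), Thm. 3.24 (p. 15), Thm. 3.30 and Cor. 3.31 (p. 16).
-/

noncomputable section

open scoped BigOperators

namespace Literature.Computability.AlgebraicComplexity

universe u

/-! ## The main theorem from the two deep halves -/

/-- **CVZ Cor. 3.31 as membership in `Δ(T)`, from the two deep halves**: for every `θ ∈ P([3])`,
`quantumFunctionalPoint θ ∈ asymptoticSpectrum ℂ`, assuming sub-additivity and
sub-multiplicativity of `F_θ` (index types in `Type`, universe `0`).
[cite: ChristandlVranaZuiddam2023, Cor. 3.31] -/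
theorem ChristandlVranaZuiddam2023_mem_asymptoticSpectrum_of_halves
    (h₁ : ChristandlVranaZuiddam2023_directSum_subadditive.{0}) (h₂ : ChristandlVranaZuiddam2023_kronecker_le.{0}) :
    ChristandlVranaZuiddam2023_mem_asymptoticSpectrum :=
  (ChristandlVranaZuiddam2023_universalSpectralPoint_of_halves h₁ h₂).mem_asymptoticSpectrum

/-- Membership in `Δ(T)` gives back sub-additivity (universe `0`). [cite: ChristandlVranaZuiddam2023, Cor. 3.31] -/
theorem ChristandlVranaZuiddam2023_mem_asymptoticSpectrum.directSum_subadditive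
    (h : ChristandlVranaZuiddam2023_mem_asymptoticSpectrum) : ChristandlVranaZuiddam2023_directSum_subadditive.{0} :=
  fun _θ hθ _ _ _ _ _ _ _ _ _ _ _ _ _ _ _ _ _ _ s t => (h.directSum hθ s t).le

/-- Membership in `Δ(T)` gives back sub-multiplicativity (universe `0`).
[cite: ChristandlVranaZuiddam2023, Cor. 3.31] -/
theorem ChristandlVranaZuiddam2023_mem_asymptoticSpectrum.kronecker_le
    (h : ChristandlVranaZuiddam2023_mem_asymptoticSpectrum) : ChristandlVranaZuiddam2023_kronecker_le.{0} :=
  fun _θ hθ _ _ _ _ _ _ _ _ _ _ _ _ _ _ _ _ _ _ s t => (h.kronecker hθ s t).le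

/-- **`ChristandlVranaZuiddam2023_mem_asymptoticSpectrum ↔ _directSum_subadditive.{0} ∧ _kronecker_le.{0}`**:
what remains to discharge the main theorem of CVZ in the tree is precisely the two deep
inequalities. [cite: ChristandlVranaZuiddam2023, Cor. 3.31] -/
theorem ChristandlVranaZuiddam2023_mem_asymptoticSpectrum_iff_halves :
    ChristandlVranaZuiddam2023_mem_asymptoticSpectrum ↔
      ChristandlVranaZuiddam2023_directSum_subadditive.{0} ∧ ChristandlVranaZuiddam2023_kronecker_le.{0} :=
  ⟨fun h => ⟨h.directSum_subadditive, h.kronecker_le⟩,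
    fun h => ChristandlVranaZuiddam2023_mem_asymptoticSpectrum_of_halves h.1 h.2⟩

/-- The conjunction form in universe `0` is equivalent to membership in `Δ(T)` (the bridge of
`QuantumFunctionalPoint.lean` is an equivalence). [cite: ChristandlVranaZuiddam2023, Cor. 3.31] -/
theorem ChristandlVranaZuiddam2023_mem_asymptoticSpectrum_iff_universalSpectralPoint :
    ChristandlVranaZuiddam2023_mem_asymptoticSpectrum ↔ ChristandlVranaZuiddam2023_universalSpectralPoint.{0} := by
  rw [ChristandlVranaZuiddam2023_mem_asymptoticSpectrum_iff_halves,
    ChristandlVranaZuiddam2023_universalSpectralPoint_iff_halves]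

/-- **Membership in `Δ(T)` from the next layer of the source's proof**: CVZ Lem. 3.11
(sub-additivity of the upper functional `F^θ`), Lem. 3.13 (sub-multiplicativity of `F^θ`) and
Thm. 3.30 (`E^θ = E_θ` on `P_s(B)`), vendored for the coordinate upper functional
`upperQuantumFunctional` in `QuantumFunctionalsUpper.lean`, imply that `quantumFunctionalPoint θ` is a
universal spectral point for every `θ ∈ P([3])` (the remaining ingredients Thm. 3.19.1–4 being proved).
[cite: ChristandlVranaZuiddam2023, Cor. 3.31 (from Lem. 3.11, Lem. 3.13, Thm. 3.30)] -/
theorem ChristandlVranaZuiddam2023_mem_asymptoticSpectrum_of_upper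
    (h₁ : ChristandlVranaZuiddam2023_upper_subadditive.{0})
    (h₂ : ChristandlVranaZuiddam2023_upper_submultiplicative.{0})
    (h₃ : ChristandlVranaZuiddam2023_upper_eq_lower.{0}) : ChristandlVranaZuiddam2023_mem_asymptoticSpectrum :=
  ChristandlVranaZuiddam2023_mem_asymptoticSpectrum_of_halves
    (fun _θ hθ _ _ _ _ _ _ _ _ _ _ _ _ _ _ _ _ _ _ s t =>
      quantumFunctional_directSumTensor_le_of_upper h₁ h₃ hθ s t)
    (ChristandlVranaZuiddam2023_kronecker_le_of_upper h₂ h₃)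

/-! ## Unconditional properties of the spectral map `quantumFunctionalPoint θ` -/

section Unconditional

variable {θ : Fin 3 → ℝ} (hθ : θ ∈ stdSimplex ℝ (Fin 3))
include hθ

/-- **Normalisation, proved**: `F_θ(⟨r⟩) = r` for the spectral map (CVZ Thm. 3.19.1).
[cite: ChristandlVranaZuiddam2023, Thm. 3.19.1] -/
theorem quantumFunctionalPoint_unitTensor (r : ℕ) : quantumFunctionalPoint θ (unitTensor ℂ r) = r := by
  classical
  rw [quantumFunctionalPoint_apply]
  convert ChristandlVranaZuiddam2023_unitTensor_holds θ hθ r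

/-- **Restriction monotonicity, proved**: `t ≥ s ⇒ F_θ(s) ≤ F_θ(t)` for the spectral map, all
finite index types in `Type` (CVZ Cor. 3.31, `≥`-monotone). [cite: ChristandlVranaZuiddam2023, Cor. 3.31] -/
theorem quantumFunctionalPoint_mono {ι κ μ ι' κ' μ' : Type} [Fintype ι] [Fintype κ] [Fintype μ]
    [Fintype ι'] [Fintype κ'] [Fintype μ'] {t : ι → κ → μ → ℂ} {s : ι' → κ' → μ' → ℂ}
    (hts : TensorRestrictsTo t s) : quantumFunctionalPoint θ s ≤ quantumFunctionalPoint θ t := by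
  classical
  simp only [quantumFunctionalPoint_apply]
  exact ChristandlVranaZuiddam2023_restriction_mono_holds.of_tensorRestrictsTo hθ hts

/-- **Super-additivity, proved**: `F_θ(s) + F_θ(t) ≤ F_θ(s ⊕ t)` for the spectral map
(CVZ Thm. 3.19.2). [cite: ChristandlVranaZuiddam2023, Thm. 3.19.2] -/
theorem quantumFunctionalPoint_directSum_ge {ι κ μ ι' κ' μ' : Type} [Fintype ι] [Fintype κ]
    [Fintype μ] [Fintype ι'] [Fintype κ'] [Fintype μ'] (s : ι → κ → μ → ℂ) (t : ι' → κ' → μ' → ℂ) :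
    quantumFunctionalPoint θ s + quantumFunctionalPoint θ t ≤
      quantumFunctionalPoint θ (directSumTensor s t) := by
  classical
  simp only [quantumFunctionalPoint_apply]
  convert quantumFunctional_add_le_directSumTensor hθ s t

/-- **Super-multiplicativity, proved**: `F_θ(s) F_θ(t) ≤ F_θ(s ⊗ t)` for the spectral map
(CVZ Thm. 3.19.3). [cite: ChristandlVranaZuiddam2023, Thm. 3.19.3] -/
theorem quantumFunctionalPoint_kronecker_ge {ι κ μ ι' κ' μ' : Type} [Fintype ι] [Fintype κ]
    [Fintype μ] [Fintype ι'] [Fintype κ'] [Fintype μ'] (s : ι → κ → μ → ℂ) (t : ι' → κ' → μ' → ℂ) :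
    quantumFunctionalPoint θ s * quantumFunctionalPoint θ t ≤
      quantumFunctionalPoint θ (kroneckerTensor s t) := by
  classical
  simp only [quantumFunctionalPoint_apply]
  convert ChristandlVranaZuiddam2023_kronecker_ge θ hθ s t

/-- **Membership in `Δ(T)` reduces to the two `≤` inequalities for the spectral map itself**: if
`quantumFunctionalPoint θ` is sub-additive and sub-multiplicative on finite index types in `Type`,
it is a universal spectral point (the other three axioms and the two `≥` halves being proved).
[cite: ChristandlVranaZuiddam2023, Cor. 3.31] -/
theorem isUniversalSpectralPoint_quantumFunctionalPoint_of_le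
    (h₁ : ∀ {ι κ μ ι' κ' μ' : Type} [Fintype ι] [Fintype κ] [Fintype μ] [Fintype ι'] [Fintype κ']
      [Fintype μ'] (s : ι → κ → μ → ℂ) (t : ι' → κ' → μ' → ℂ),
      quantumFunctionalPoint θ (directSumTensor s t) ≤ quantumFunctionalPoint θ s + quantumFunctionalPoint θ t)
    (h₂ : ∀ {ι κ μ ι' κ' μ' : Type} [Fintype ι] [Fintype κ] [Fintype μ] [Fintype ι'] [Fintype κ']
      [Fintype μ'] (s : ι → κ → μ → ℂ) (t : ι' → κ' → μ' → ℂ),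
      quantumFunctionalPoint θ (kroneckerTensor s t) ≤ quantumFunctionalPoint θ s * quantumFunctionalPoint θ t) :
    IsUniversalSpectralPoint ℂ (quantumFunctionalPoint θ) := by
  refine ⟨?_, ?_, ?_, ?_, ?_⟩
  · intro ι κ μ _ _ _ t
    exact quantumFunctionalPoint_nonneg θ t
  · intro ι κ μ ι' κ' μ' _ _ _ _ _ _ s t
    exact le_antisymm (h₁ s t) (quantumFunctionalPoint_directSum_ge hθ s t)
  · intro ι κ μ ι' κ' μ' _ _ _ _ _ _ s t
    exact le_antisymm (h₂ s t) (quantumFunctionalPoint_kronecker_ge hθ s t)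
  · have h := quantumFunctionalPoint_unitTensor hθ 1
    simpa using h
  · intro ι κ μ ι' κ' μ' _ _ _ _ _ _ t s hts
    exact quantumFunctionalPoint_mono hθ hts

end Unconditional

/-! ## Invariance under the equivalence `∼` (padding with zero blocks) -/

section Padding

variable {θ : Fin 3 → ℝ} (hθ : θ ∈ stdSimplex ℝ (Fin 3))
include hθ

/-- **`F_θ` is constant on restriction-equivalence classes**: if `[s] = [t]` in the tensor semiring
`T(ℂ)` (i.e. `s ≥ t` and `t ≥ s`) then `F_θ(s) = F_θ(t)` (CVZ §1.2: spectral points are functions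
on `T`; here from restriction monotonicity, Cor. 3.31). [cite: ChristandlVranaZuiddam2023, §1.2 (p. 6) and Cor. 3.31] -/
theorem quantumFunctional_eq_of_mk_eq_mk {ι κ μ ι' κ' μ' : Type u} [Fintype ι] [Fintype κ] [Fintype μ]
    [Fintype ι'] [Fintype κ'] [Fintype μ'] [DecidableEq ι] [DecidableEq κ] [DecidableEq μ]
    [DecidableEq ι'] [DecidableEq κ'] [DecidableEq μ'] {s : ι → κ → μ → ℂ} {t : ι' → κ' → μ' → ℂ}
    (h : TensorClass.mk s = TensorClass.mk t) : quantumFunctional θ s = quantumFunctional θ t := by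
  obtain ⟨h₁, h₂⟩ := TensorClass.mk_eq_mk_iff.1 h
  exact le_antisymm
    (ChristandlVranaZuiddam2023_restriction_mono_holds.of_tensorRestrictsTo hθ h₁)
    (ChristandlVranaZuiddam2023_restriction_mono_holds.of_tensorRestrictsTo hθ h₂)

/-- **Padding invariance** (CVZ Rem. 3.17; the equivalence `s ⊕ 0 ∼ s` of §1.2):
`F_θ(s ⊕ 0) = F_θ(s)` for a zero tensor of any format. [cite: ChristandlVranaZuiddam2023, Rem. 3.17] -/
theorem quantumFunctional_directSumTensor_zero_right {ι κ μ ι' κ' μ' : Type u} [Fintype ι] [Fintype κ]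
    [Fintype μ] [Fintype ι'] [Fintype κ'] [Fintype μ'] [DecidableEq ι] [DecidableEq κ] [DecidableEq μ]
    [DecidableEq ι'] [DecidableEq κ'] [DecidableEq μ'] (s : ι → κ → μ → ℂ) :
    quantumFunctional θ (directSumTensor s (0 : ι' → κ' → μ' → ℂ)) = quantumFunctional θ s := by
  refine quantumFunctional_eq_of_mk_eq_mk hθ ?_
  rw [← TensorClass.mk_add_mk, TensorClass.mk_zero, add_zero]

/-- **Padding invariance** (CVZ Rem. 3.17): `F_θ(0 ⊕ t) = F_θ(t)`. [cite: ChristandlVranaZuiddam2023, Rem. 3.17] -/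
theorem quantumFunctional_directSumTensor_zero_left {ι κ μ ι' κ' μ' : Type u} [Fintype ι] [Fintype κ]
    [Fintype μ] [Fintype ι'] [Fintype κ'] [Fintype μ'] [DecidableEq ι] [DecidableEq κ] [DecidableEq μ]
    [DecidableEq ι'] [DecidableEq κ'] [DecidableEq μ'] (t : ι' → κ' → μ' → ℂ) :
    quantumFunctional θ (directSumTensor (0 : ι → κ → μ → ℂ) t) = quantumFunctional θ t := by
  refine quantumFunctional_eq_of_mk_eq_mk hθ ?_
  rw [← TensorClass.mk_add_mk, TensorClass.mk_zero, zero_add]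

end Padding

end Literature.Computability.AlgebraicComplexity

end
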